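import Literature.NumberTheory.Automorphic.BockleHuiIrreducibleGL3NoContragredientProofs
import Literature.NumberTheory.Automorphic.PairLFunctionPolesRepDataBoundaryRankOne
import Literature.NumberTheory.Automorphic.KimExteriorSquareGL4Proofs
import HarnessLib

/-!
# No Hecke character among the Satake eigenvalues of a cuspidal `π` on `GL₄` with cuspidal
# exterior square (the `(3,1)` case of a reducible compatible system is empty) — proofs only

Topic `NumberTheory/Automorphic`; namespace `Literature.NumberTheory.Automorphic`.  PROOFS file (theorems
only: no definition, no named fact, no `sorry`), the `n = 4` twin of the tree's Böckle–Hui §3.2.1 files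
`BockleHuiIrreducibleGL3{Analytic,Weight,NoContragredient}Proofs` (there: no Hecke character `μ` with
`∏ t_{π,v} ≠ μ(ϖ_v)³` among the Satake eigenvalues of a cuspidal `π` on `GL₃`).  Here: let `π` be a
cuspidal Borel–Jacquet datum on `GL₄(𝔸_F)` whose exterior-square Satake data `∧² t_{π,v}`
(`wedgeTwoParams`) are, at almost every place, those of a CUSPIDAL datum `Π` on `GL₆(𝔸_F)`; then NO
Hecke character `μ` has `μ(ϖ_v) ∈ t_{π,v}` at almost every `v` — granting Jacquet–Shalika (2.2) for
Borel–Jacquet data (`JacquetShalika1981_partialPairL_boundary_repData`; (2.1), the pole of `ζ_F^S` and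
(2.2) in ranks `(1, 1)` being THEOREMS of the tree).  This is the analytic half of the `(3,1)` case in
A. Shavali, *Irreducibility and monodromy of automorphic Galois representations of `GL(4)`*,
arXiv:2603.19768 (2026), Prop. 4.1 (there under the running hypotheses of loc. cit.; here for any
number field and WITHOUT any weight or regularity hypothesis, the slope of `μ` being disposed of by
running the identity off the unitary axis, as `norm_prod_satake_eq_norm_cube_of_JS` does for `n = 3`).

## The argument

With `m = μ(ϖ_v) ∈ t = t_{π,v} = {m, a, b, c}` and `ω = det t = ω_π(ϖ_v)`, the eight-term identity
`∧²t · m⁻² ⊎ {ω m⁻⁴} ⊎ {1} = t⁻¹ · ω m⁻³ ⊎ t · m⁻¹` (both sides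
`{ab/m², ac/m², bc/m², a/m, b/m, c/m, abc/m³, 1}`; `satakePairPolynomial_threeOne_identity`) reads
`L^S(s, Π × μ⁻²) L^S(s, ω μ⁻⁴) ζ_F^S(s) = L^S(s, π^∨ × ω μ⁻³) L^S(s, π × μ⁻¹)`.
After the unitary normalisation (`|det t| = 1`, `|μ(ϖ_v)| = q_v^{t}`):
* `t = 0` (`false_of_eulerIdentity_threeOne_of_packages`): the left side has at `s = 1` a pole of
  order `1 + [ω μ⁻⁴ = 1 a.e.]` (Hecke's pole of `ζ_F^S`; (2.2) non-vanishing for `GL₆ × GL₁`; for the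
  `GL₁ × GL₁` factor either the THEOREM `JacquetShalika1981_partialPairL_boundary_repData_one_one` or a
  second copy of `ζ_F^S`), the right side is finite ((2.2) for `GL₄ × GL₁`, `4 ≠ 1`);
* `t > 0` (`false_of_eulerIdentity_threeOne_of_shift_of_packages`): all four twists are shifted INTO
  `Re s > 1`, where partial Rankin–Selberg `L`-functions of unitary data are continuous and non-zero
  (Jacquet–Shalika I, Thm. 5.3: `continuousAt_and_ne_zero_partialPairL_repData`), against the pole of
  `ζ_F^S`;
* `t < 0` is reduced to `t > 0` by the caller on the dual data (`π^∨`, `Π ⊗ ω⁻¹`, `μ⁻¹`;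
  `∧²(t⁻¹) = ω⁻¹ ∧²t`, `wedgeTwoParams_map_inv_eq_map_prod_inv_mul`).
The `GL₆ × GL₁` / `GL₄ × GL₁` slots enter only through analytic packages (`analyticPackage_repData`),
so the contragredient is any datum with the inverse Satake family
(`false_of_heckeEigenvalue_mem_satake_gl4`).

## References

* A. Shavali, arXiv:2603.19768 (2026), Prop. 4.1 (the `(3,1)` case). [Shavali2026GL4]
* G. Böckle, C.-Y. Hui, *Weak abelian direct summands and irreducibility of Galois representations*,
  Math. Ann. 393 (2025), §3.2.1. [BockleHui2025]
* J. Arthur, L. Clozel, Ann. of Math. Stud. 120 (1989), Ch. 3 §2, (2.1)–(2.3). [ArthurClozelAMS120]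
* H. Jacquet, J. A. Shalika, Amer. J. Math. 103 (1981), I Thm. (5.3); II Prop. 3.6, Thm. 4.4.
  [JacquetShalikaAJM1981] [JacquetShalikaAJM1981II]
* H. H. Kim, *Functoriality for the exterior square of `GL₄`*, J. Amer. Math. Soc. 16 (2003). [Kim2002]
-/

noncomputable section

open scoped MatrixGroups Topology Classical NumberField
open NumberField IsDedekindDomain Filter Polynomial

namespace Literature.NumberTheory.Automorphic

open Literature.NumberTheory.GaloisRepresentations (HeckeCharacter ideleGroup)

/-! ### Bookkeeping -/

section Bookkeeping

variable {F : Type} [Field F] [NumberField F]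

/-- `‖(q_v : ℂ) ^ z‖ = q_v ^ {re z}`. [folklore] -/
private theorem norm_qpow_gl4 (v : HeightOneSpectrum (𝓞 F)) (z : ℂ) :
    ‖(v.residueCard : ℂ) ^ z‖ = (v.residueCard : ℝ) ^ z.re :=
  Complex.norm_natCast_cpow_of_pos (Nat.zero_lt_of_lt v.one_lt_residueCard) z

/-- `(q_v : ℂ) ^ z ≠ 0`. [folklore] -/
private theorem qpow_ne_zero_gl4 (v : HeightOneSpectrum (𝓞 F)) (z : ℂ) :
    (v.residueCard : ℂ) ^ z ≠ 0 := by
  have hq : (v.residueCard : ℂ) ≠ 0 :=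
    Nat.cast_ne_zero.2 (ne_of_gt (lt_trans zero_lt_one v.one_lt_residueCard))
  exact fun h => hq ((Complex.cpow_eq_zero_iff _ _).1 h).1

/-- **`|χ(ϖ_v)| = q_v^{-σ}` when `|χ| = ‖·‖^{σ}` on ideles** (`‖ϖ_v‖ = q_v⁻¹`), through the
norm-power character `‖·‖^{σ}` (`HeckeCharacter.valueAtUniformizer_of_cpow`). [folklore] -/
theorem norm_valueAtUniformizer_eq_rpow_neg_of_norm_apply {χ : HeckeCharacter F} {σ : ℝ}
    (hσ : ∀ x : ideleGroup F, ‖((χ x : ℂˣ) : ℂ)‖ = GaloisRepresentations.ideleNorm x ^ σ)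
    (v : HeightOneSpectrum (𝓞 F)) :
    ‖χ.valueAtUniformizer v‖ = (v.residueCard : ℝ) ^ (-σ) := by
  obtain ⟨lam, hlam⟩ := exists_heckeCharacter_ideleNorm_cpow F (σ : ℂ)
  have hχlam : ∀ x : ideleGroup F, ‖((χ x : ℂˣ) : ℂ)‖ = ‖((lam x : ℂˣ) : ℂ)‖ := fun x => by
    rw [hσ x, hlam x, Complex.norm_cpow_eq_rpow_re_of_pos (HeckeCharacter.ideleNorm_pos' _ x),
      Complex.ofReal_re]
  have h1 : ‖χ.valueAtUniformizer v‖ = ‖lam.valueAtUniformizer v‖ := by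
    simp only [GaloisRepresentations.HeckeCharacter.valueAtUniformizer,
      GaloisRepresentations.HeckeCharacter.localComponent_apply]
    exact hχlam _
  rw [h1, HeckeCharacter.valueAtUniformizer_of_cpow hlam v, norm_inv,
    Complex.norm_natCast_cpow_of_pos (Nat.zero_lt_of_lt v.one_lt_residueCard), Complex.ofReal_re,
    Real.rpow_neg (Nat.cast_nonneg _)]

/-- Shifting no family: `γ w = q_w^{0} γ w`. [folklore] -/
private theorem shift_zero_gl4 {S : Set (HeightOneSpectrum (𝓞 F))} (γ : SatakeFamily F) :
    ∀ w ∉ S, γ w = (γ w).map (((w.residueCard : ℂ) ^ (0 : ℂ)) * ·) := fun w _ => by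
  simp only [Complex.cpow_zero, one_mul, Multiset.map_id']

/-- A Satake family of `π` (choice of a Satake parameter at every unramified place). [folklore] -/
theorem exists_satakeFamily_eventually_hasSatakeParamAt {n : ℕ}
    {h : isCompact_glFiniteIntegralLevel n F} (π : AutomorphicRepData (AutomorphyDatum.gl n F h)) :
    ∃ f : SatakeFamily F, ∀ᶠ w : HeightOneSpectrum (𝓞 F) in cofinite, π.HasSatakeParamAt w (f w) :=
  ⟨fun w => if hw : π.IsUnramifiedAt w then hw.choose else 0, by
    filter_upwards [π.hasSatakeParamAt_cofinite_holds] with w hw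
    rw [dif_pos hw]
    exact hw.choose_spec⟩

/-- **An identity of partial `L`-functions, three factors against two, from an identity of Euler
factors**: if off `S` `P(p, q) P(p', q') P(p'', q'') = P(a, b) P(a', b')` and the five Euler products
are multipliable at `s`, then `L^S(p ⊗ q) L^S(p' ⊗ q') L^S(p'' ⊗ q'') = L^S(a ⊗ b) L^S(a' ⊗ b')` at
`s`. [folklore] -/
theorem partialPairL_mul_mul_eq_mul_of_satakePairPolynomial_eq {S : Set (HeightOneSpectrum (𝓞 F))}
    {p q p' q' p'' q'' a b a' b' : SatakeFamily F}
    (hId : ∀ v ∉ S, satakePairPolynomial (p v) (q v) * satakePairPolynomial (p' v) (q' v) *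
        satakePairPolynomial (p'' v) (q'' v) =
      satakePairPolynomial (a v) (b v) * satakePairPolynomial (a' v) (b' v))
    {s : ℂ}
    (hpq : Multipliable fun v : {v : HeightOneSpectrum (𝓞 F) // v ∉ S} =>
      ((satakePairPolynomial (p v.1) (q v.1)).eval ((v.1.residueCard : ℂ) ^ (-s)))⁻¹)
    (hpq' : Multipliable fun v : {v : HeightOneSpectrum (𝓞 F) // v ∉ S} =>
      ((satakePairPolynomial (p' v.1) (q' v.1)).eval ((v.1.residueCard : ℂ) ^ (-s)))⁻¹)
    (hpq'' : Multipliable fun v : {v : HeightOneSpectrum (𝓞 F) // v ∉ S} =>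
      ((satakePairPolynomial (p'' v.1) (q'' v.1)).eval ((v.1.residueCard : ℂ) ^ (-s)))⁻¹)
    (hab : Multipliable fun v : {v : HeightOneSpectrum (𝓞 F) // v ∉ S} =>
      ((satakePairPolynomial (a v.1) (b v.1)).eval ((v.1.residueCard : ℂ) ^ (-s)))⁻¹)
    (hab' : Multipliable fun v : {v : HeightOneSpectrum (𝓞 F) // v ∉ S} =>
      ((satakePairPolynomial (a' v.1) (b' v.1)).eval ((v.1.residueCard : ℂ) ^ (-s)))⁻¹) :
    partialPairL S p q s * partialPairL S p' q' s * partialPairL S p'' q'' s =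
      partialPairL S a b s * partialPairL S a' b' s := by
  unfold partialPairL
  rw [← hpq.tprod_mul hpq', ← (hpq.mul hpq').tprod_mul hpq'', ← hab.tprod_mul hab']
  congr 1
  funext v
  rw [← mul_inv, ← mul_inv, ← mul_inv, ← eval_mul, ← eval_mul, ← eval_mul, hId v.1 v.2]

/-- **Pole bookkeeping, three factors against two.**  Along a non-trivial filter `l` with
`s - 1 → 0`: if `A · N · Z = B · C` eventually, `A → a ≠ 0`, `(s - 1)^k N → n ≠ 0`,
`(s - 1) Z → z ≠ 0` while `B → b`, `C → c` are finite, then multiplying by `(s - 1)^{k+1}` gives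
`a n z = 0`, a contradiction. [folklore] -/
theorem false_of_pole_pole_nonzero_eq_finite {l : Filter ℂ} [l.NeBot] {A N Z B C : ℂ → ℂ}
    {a n z b c : ℂ} (k : ℕ) (hsub : Tendsto (fun s => s - 1) l (𝓝 0))
    (hEq : ∀ᶠ s in l, A s * N s * Z s = B s * C s)
    (hA : Tendsto A l (𝓝 a)) (ha : a ≠ 0)
    (hN : Tendsto (fun s => (s - 1) ^ k * N s) l (𝓝 n)) (hn : n ≠ 0)
    (hZ : Tendsto (fun s => (s - 1) * Z s) l (𝓝 z)) (hz : z ≠ 0)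
    (hB : Tendsto B l (𝓝 b)) (hC : Tendsto C l (𝓝 c)) : False := by
  have h1 : Tendsto (fun s => A s * ((s - 1) ^ k * N s) * ((s - 1) * Z s)) l (𝓝 (a * n * z)) :=
    (hA.mul hN).mul hZ
  have h2 : Tendsto (fun s => (s - 1) ^ k * (s - 1) * (B s * C s)) l
      (𝓝 ((0 : ℂ) ^ k * 0 * (b * c))) :=
    ((hsub.pow k).mul hsub).mul (hB.mul hC)
  rw [mul_zero, zero_mul] at h2
  have heq : (fun s => (s - 1) ^ k * (s - 1) * (B s * C s)) =ᶠ[l]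
      fun s => A s * ((s - 1) ^ k * N s) * ((s - 1) * Z s) :=
    hEq.mono fun s hs => by simp only [← hs]; ring
  exact mul_ne_zero (mul_ne_zero ha hn) hz (tendsto_nhds_unique h1 (h2.congr' heq))

end Bookkeeping

/-! ### The Euler-factor identity of the `(3,1)` case and `∧²` of the dual parameter -/

section Algebra

/-- **The eight-term identity of the `(3,1)` case, factor by factor.**  For `t = {m, a, b, c}`
(all `≠ 0`) and `ω = m a b c`:
`P(∧² t, m⁻²) · P(ω m⁻⁴, 1) · P(1, 1) = P(t⁻¹, ω m⁻³) · P(t, m⁻¹)`, both sides being the Euler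
polynomial of `{ab/m², ac/m², bc/m², a/m, b/m, c/m, abc/m³, 1}` — the unramified factors of
`L(Π × μ⁻²) L(ω_π μ⁻⁴) ζ_K = L(π^∨ × ω_π μ⁻³) L(π × μ⁻¹)` for `Π = ∧² π` and `μ(ϖ) = m ∈ t_π`
(Shavali 2026, arXiv:2603.19768, proof of Prop. 4.1; the `n = 4` analogue of
`satakePairPolynomial_bh_identity` of Böckle–Hui §3.2.1). [cite: BockleHui2025, §3.2.1] -/
theorem satakePairPolynomial_threeOne_identity {a b c m : ℂ} (ha : a ≠ 0) (hb : b ≠ 0) (hc : c ≠ 0)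
    (hm : m ≠ 0) :
    satakePairPolynomial (wedgeTwoParams (m ::ₘ {a, b, c})) {(m ^ 2)⁻¹} *
        satakePairPolynomial {m * (a * (b * c)) * (m ^ 4)⁻¹} {1} *
        satakePairPolynomial {1} {1} =
      satakePairPolynomial ((m ::ₘ {a, b, c}).map (·⁻¹)) {m * (a * (b * c)) * (m ^ 3)⁻¹} *
        satakePairPolynomial (m ::ₘ {a, b, c}) {m⁻¹} := by
  have e1 : (m ^ 2)⁻¹ * (m * a) = m⁻¹ * a := by field_simp
  have e2 : (m ^ 2)⁻¹ * (m * b) = m⁻¹ * b := by field_simp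
  have e3 : (m ^ 2)⁻¹ * (m * c) = m⁻¹ * c := by field_simp
  have e4 : (m ^ 2)⁻¹ = m⁻¹ ^ 2 := by rw [inv_pow]
  have e5 : m * (a * (b * c)) * (m ^ 4)⁻¹ = m⁻¹ ^ 3 * (a * (b * c)) := by field_simp
  have e6 : m * (a * (b * c)) * (m ^ 3)⁻¹ * m⁻¹ = m⁻¹ ^ 3 * (a * (b * c)) := by field_simp
  have e7 : m * (a * (b * c)) * (m ^ 3)⁻¹ * a⁻¹ = m⁻¹ ^ 2 * (b * c) := by field_simp
  have e8 : m * (a * (b * c)) * (m ^ 3)⁻¹ * b⁻¹ = m⁻¹ ^ 2 * (a * c) := by field_simp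
  have e9 : m * (a * (b * c)) * (m ^ 3)⁻¹ * c⁻¹ = m⁻¹ ^ 2 * (a * b) := by field_simp
  have e10 : m⁻¹ * m = 1 := inv_mul_cancel₀ hm
  simp only [satakePairPolynomial_eq_eulerPolynomial, satakeTensor_comm _ ({(m ^ 2)⁻¹} : Multiset ℂ),
    satakeTensor_comm _ ({1} : Multiset ℂ), satakeTensor_comm _ ({m⁻¹} : Multiset ℂ),
    satakeTensor_comm _ ({m * (a * (b * c)) * (m ^ 3)⁻¹} : Multiset ℂ),
    satakeTensor_singleton_left, Multiset.insert_eq_cons, wedgeTwoParams_cons,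
    wedgeTwoParams_singleton, Multiset.map_add, add_zero,
    Multiset.map_cons, Multiset.map_singleton, eulerPolynomial_add, eulerPolynomial_cons, one_mul]
  rw [e1, e2, e3, e4, e5, e6, e7, e8, e9, e10]
  simp only [eulerPolynomial, Multiset.map_singleton, Multiset.prod_singleton, map_mul, map_pow]
  ring

/-- **`∧²` of the dual parameter is a twist of `∧²`** (essential self-duality of `∧²` on `GL₄`):
for `card α = 4` without zero entry, `∧²(α⁻¹) = (∏ α)⁻¹ · ∧² α`, from
`map_prod_mul_inv_wedgeTwoParams_of_card_eq_four` and `wedgeTwoParams_map_inv`. [folklore] -/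
theorem wedgeTwoParams_map_inv_eq_map_prod_inv_mul {α : Multiset ℂ} (h4 : Multiset.card α = 4)
    (h0 : (0 : ℂ) ∉ α) :
    wedgeTwoParams (α.map (·⁻¹)) = (wedgeTwoParams α).map ((α.prod)⁻¹ * ·) := by
  rw [wedgeTwoParams_map_inv]
  conv_lhs => rw [← map_prod_mul_inv_wedgeTwoParams_of_card_eq_four h4 h0]
  rw [Multiset.map_map]
  refine Multiset.map_congr rfl fun x _ => ?_
  simp only [Function.comp_apply, mul_inv, inv_inv]

end Algebra

/-! ### The two analytic cores with abstract `GL₆ × GL₁` and `GL₄ × GL₁` slots -/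

section Abstract

variable {F : Type} [Field F] [NumberField F]

/-- **The `(3,1)` identity ON the unitary axis is contradictory** (abstract slots).  Let `τ₀`, `τν`
be cuspidal data on `GL(1)` with Satake families `{1}`, `tν` (unitary) off a finite `T`, and let
`(W, t₂)`, `(βi, tκ)`, `(β, t₁)` be three pairs of Satake families whose partial Rankin–Selberg
`L`-functions off every finite `S ⊇ T` are multipliable on `Re s > 1` and have finite limits as
`s → 1`, `Re s > 1`, the first one NON-ZERO (the analytic packages of `L^S(s, Π × μ⁻²)`,
`L^S(s, π^∨ × ω μ⁻³)`, `L^S(s, π × μ⁻¹)`; Jacquet–Shalika (2.1)–(2.2) for `GL₆ × GL₁`, `GL₄ × GL₁`).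
If the Euler factors satisfy `P(W, t₂) P(tν, 1) P(1, 1) = P(βi, tκ) P(β, t₁)` off `T`, then `False`:
the left side has at `s = 1` a pole of order `1 + [tν = 1 a.e.]` (Hecke's pole of `ζ_F^S`,
`tendsto_sub_one_mul_partialPairL_one_one`; for `tν ≠ 1` i.o. the finite non-zero boundary value of
`L^S(s, tν)` by Jacquet–Shalika (2.2) on `GL₁ × GL₁`, the THEOREM
`JacquetShalika1981_partialPairL_boundary_repData_one_one`; for `tν = 1` a.e. a second copy of
`ζ_F^S`), the right side is finite (`false_of_pole_pole_nonzero_eq_finite`).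
[cite: BockleHui2025, §3.2.1] [cite: ArthurClozelAMS120, Ch. 3 §2 (2.1)–(2.3)] -/
theorem false_of_eulerIdentity_threeOne_of_packages
    {h1 : isCompact_glFiniteIntegralLevel 1 F}
    (τ₀ τν : CuspidalAutomorphicRepData 1 F h1)
    (one t₂ tν tκ t₁ W βi β : SatakeFamily F) {T : Set (HeightOneSpectrum (𝓞 F))} (hT : T.Finite)
    (hone : ∀ w, one w = {1})
    (hτ₀ : ∀ w ∉ T, τ₀.1.HasSatakeParamAt w (one w))
    (hτν : ∀ w ∉ T, τν.1.HasSatakeParamAt w (tν w)) (huν : ∀ w ∉ T, ‖(tν w).prod‖ = 1)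
    (hmA : ∀ {S : Set (HeightOneSpectrum (𝓞 F))}, S.Finite → T ⊆ S → ∀ s : ℂ, 1 < s.re →
      Multipliable fun v : {v : HeightOneSpectrum (𝓞 F) // v ∉ S} =>
        ((satakePairPolynomial (W v.1) (t₂ v.1)).eval ((v.1.residueCard : ℂ) ^ (-s)))⁻¹)
    (hbA : ∀ {S : Set (HeightOneSpectrum (𝓞 F))}, S.Finite → T ⊆ S →
      ∃ c : ℂ, c ≠ 0 ∧ Tendsto (partialPairL S W t₂) (𝓝[{s : ℂ | 1 < s.re}] 1) (𝓝 c))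
    (hmB : ∀ {S : Set (HeightOneSpectrum (𝓞 F))}, S.Finite → T ⊆ S → ∀ s : ℂ, 1 < s.re →
      Multipliable fun v : {v : HeightOneSpectrum (𝓞 F) // v ∉ S} =>
        ((satakePairPolynomial (βi v.1) (tκ v.1)).eval ((v.1.residueCard : ℂ) ^ (-s)))⁻¹)
    (hbB : ∀ {S : Set (HeightOneSpectrum (𝓞 F))}, S.Finite → T ⊆ S →
      ∃ c : ℂ, Tendsto (partialPairL S βi tκ) (𝓝[{s : ℂ | 1 < s.re}] 1) (𝓝 c))
    (hmC : ∀ {S : Set (HeightOneSpectrum (𝓞 F))}, S.Finite → T ⊆ S → ∀ s : ℂ, 1 < s.re →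
      Multipliable fun v : {v : HeightOneSpectrum (𝓞 F) // v ∉ S} =>
        ((satakePairPolynomial (β v.1) (t₁ v.1)).eval ((v.1.residueCard : ℂ) ^ (-s)))⁻¹)
    (hbC : ∀ {S : Set (HeightOneSpectrum (𝓞 F))}, S.Finite → T ⊆ S →
      ∃ c : ℂ, Tendsto (partialPairL S β t₁) (𝓝[{s : ℂ | 1 < s.re}] 1) (𝓝 c))
    (hId : ∀ w ∉ T, satakePairPolynomial (W w) (t₂ w) * satakePairPolynomial (tν w) (one w) *
        satakePairPolynomial (one w) (one w) =
      satakePairPolynomial (βi w) (tκ w) * satakePairPolynomial (β w) (t₁ w)) :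
    False := by
  have hJ1 := JacquetShalika1981_multipliable_partialPairL_repData_holds
  obtain ⟨S₂, hS₂, hJ1b⟩ := hJ1 1 1 F h1 h1 one_pos one_pos τν τ₀
  obtain ⟨S₃, hS₃, hJ1c⟩ := hJ1 1 1 F h1 h1 one_pos one_pos τ₀ τ₀
  -- the `GL₁ × GL₁` slot `N = L^S(s, tν)`: a pole of order `k ∈ {0, 1}` at `s = 1`
  obtain ⟨E, hE, hN⟩ : ∃ E : Set (HeightOneSpectrum (𝓞 F)), E.Finite ∧
      ∀ {S : Set (HeightOneSpectrum (𝓞 F))}, S.Finite → E ⊆ S → T ⊆ S →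
        ∃ (k : ℕ) (n : ℂ), n ≠ 0 ∧
          Tendsto (fun s => (s - 1) ^ k * partialPairL S tν one s) (𝓝[{s : ℂ | 1 < s.re}] 1)
            (𝓝 n) := by
    by_cases hX : ∀ᶠ w : HeightOneSpectrum (𝓞 F) in cofinite, tν w = {1}
    · refine ⟨{w | ¬ tν w = {1}}, Filter.eventually_cofinite.1 hX, fun {S} hS hES _ => ⟨1, ?_⟩⟩
      have heq : partialPairL S tν one = partialPairL S one one := by
        funext s
        unfold partialPairL
        congr 1
        funext v
        rw [show tν v.1 = one v.1 from (not_not.1 fun h => v.2 (hES h)).trans (hone v.1).symm]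
      obtain ⟨c₀, hc₀, hZ⟩ := tendsto_sub_one_mul_partialPairL_one_one hS hone
      exact ⟨c₀, hc₀, by simpa only [pow_one, heq] using hZ⟩
    · obtain ⟨S₆, hS₆, hJ2b⟩ := JacquetShalika1981_partialPairL_boundary_repData_one_one h1 h1 τν τ₀
      refine ⟨S₆, hS₆, fun {S} hS h6S hTS => ⟨0, ?_⟩⟩
      obtain ⟨c₃, hc₃, hLν⟩ := hJ2b hS h6S (fun w hw => hτν w (fun h => hw (hTS h)))
        (fun w hw => hτ₀ w (fun h => hw (hTS h))) (fun w hw => huν w (fun h => hw (hTS h)))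
        (fun w _ => by rw [hone]; simp) Complex.one_re
        (fun h => hX (h.2.mono fun w hw => by simpa [hone, sub_self, Complex.cpow_zero] using hw))
      exact ⟨c₃, hc₃, by simpa only [pow_zero, one_mul] using hLν⟩
  set S : Set (HeightOneSpectrum (𝓞 F)) := T ∪ S₂ ∪ S₃ ∪ E with hS_def
  have hS : S.Finite := ((hT.union hS₂).union hS₃).union hE
  have hTS' : T ⊆ S := fun x hx => by simp [hS_def, hx]
  have hTS : ∀ w ∉ S, w ∉ T := fun w hw hwT => hw (hTS' hwT)
  have sub₂ : S₂ ⊆ S := fun x hx => by simp [hS_def, hx]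
  have sub₃ : S₃ ⊆ S := fun x hx => by simp [hS_def, hx]
  have subE : E ⊆ S := fun x hx => by simp [hS_def, hx]
  have hτ₀S : ∀ w ∉ S, τ₀.1.HasSatakeParamAt w (one w) := fun w hw => hτ₀ w (hTS w hw)
  have hτνS : ∀ w ∉ S, τν.1.HasSatakeParamAt w (tν w) := fun w hw => hτν w (hTS w hw)
  have huone : ∀ w ∉ S, ‖(one w).prod‖ = 1 := fun w _ => by rw [hone]; simp
  have huνS : ∀ w ∉ S, ‖(tν w).prod‖ = 1 := fun w hw => huν w (hTS w hw)
  -- (2.1)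
  have mN : ∀ s : ℂ, 1 < s.re → Multipliable fun v : {v : HeightOneSpectrum (𝓞 F) // v ∉ S} =>
      ((satakePairPolynomial (tν v.1) (one v.1)).eval ((v.1.residueCard : ℂ) ^ (-s)))⁻¹ :=
    fun s hs => hJ1b hS sub₂ hτνS hτ₀S huνS huone hs
  have mZ : ∀ s : ℂ, 1 < s.re → Multipliable fun v : {v : HeightOneSpectrum (𝓞 F) // v ∉ S} =>
      ((satakePairPolynomial (one v.1) (one v.1)).eval ((v.1.residueCard : ℂ) ^ (-s)))⁻¹ :=
    fun s hs => hJ1c hS sub₃ hτ₀S hτ₀S huone huone hs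
  -- the limits of the five factors
  obtain ⟨a, ha, hA⟩ := hbA hS hTS'
  obtain ⟨k, n, hn, hNk⟩ := hN hS subE hTS'
  obtain ⟨c₀, hc₀, hZ⟩ := tendsto_sub_one_mul_partialPairL_one_one hS hone
  obtain ⟨b, hB⟩ := hbB hS hTS'
  obtain ⟨c, hC⟩ := hbC hS hTS'
  refine false_of_pole_pole_nonzero_eq_finite (l := 𝓝[{s : ℂ | 1 < s.re}] 1) k
    tendsto_sub_one_nhdsWithin_one_lt_re ?_ hA ha hNk hn hZ hc₀ hB hC
  refine eventually_nhdsWithin_of_forall fun s hs => ?_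
  exact partialPairL_mul_mul_eq_mul_of_satakePairPolynomial_eq (fun v hv => hId v (hTS v hv))
    (hmA hS hTS' s hs) (mN s hs) (mZ s hs) (hmB hS hTS' s hs) (hmC hS hTS' s hs)

/-- **The `(3,1)` identity OFF the unitary axis is contradictory** (abstract slots).  As
`false_of_eulerIdentity_threeOne_of_packages`, with unitary `GL₁` families `u₂`, `uν`, `uκ`, `u₁` and a
shift `t > 0`: if off `T`
`P(W, q^{-2t} u₂) P(q^{-4t} uν, 1) P(1, 1) = P(βi, q^{-3t} uκ) P(β, q^{-t} u₁)` — the identity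
`L(Π × μ⁻²) L(ω μ⁻⁴) ζ_F = L(π^∨ × ω μ⁻³) L(π × μ⁻¹)` in which `|μ(ϖ_v)| = q_v^{t}` — and the pairs
`(W, u₂)`, `(βi, uκ)`, `(β, u₁)` have analytic packages on `Re s > 1` (multipliable; continuous, and
for the first one non-zero, at every point; Jacquet–Shalika I, Thm. 5.3), then `False`: on `Re s > 1`
the identity reads `A(s + 2t) N(s + 4t) ζ_F^S(s) = B(s + 3t) C(s + t)` (`partialPairL_eq_of_shift`)
and as `s → 1⁺` the left side is (non-zero) × (non-zero) × pole
(`continuousAt_and_ne_zero_partialPairL_repData` for `N`, Hecke for `ζ_F^S`), the right side finite.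
[cite: BockleHui2025, §3.2.1] [cite: JacquetShalikaAJM1981, Thm. (5.3)] -/
theorem false_of_eulerIdentity_threeOne_of_shift_of_packages
    {h1 : isCompact_glFiniteIntegralLevel 1 F}
    (τ₀ τν : CuspidalAutomorphicRepData 1 F h1)
    (one u₂ uν uκ u₁ W βi β : SatakeFamily F) {T : Set (HeightOneSpectrum (𝓞 F))} (hT : T.Finite)
    (hone : ∀ w, one w = {1})
    (hτ₀ : ∀ w ∉ T, τ₀.1.HasSatakeParamAt w (one w))
    (hτν : ∀ w ∉ T, τν.1.HasSatakeParamAt w (uν w)) (huν : ∀ w ∉ T, ‖(uν w).prod‖ = 1)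
    (hmA : ∀ {S : Set (HeightOneSpectrum (𝓞 F))}, S.Finite → T ⊆ S → ∀ s : ℂ, 1 < s.re →
      Multipliable fun v : {v : HeightOneSpectrum (𝓞 F) // v ∉ S} =>
        ((satakePairPolynomial (W v.1) (u₂ v.1)).eval ((v.1.residueCard : ℂ) ^ (-s)))⁻¹)
    (hcA : ∀ {S : Set (HeightOneSpectrum (𝓞 F))}, S.Finite → T ⊆ S → ∀ s : ℂ, 1 < s.re →
      ContinuousAt (partialPairL S W u₂) s ∧ partialPairL S W u₂ s ≠ 0)
    (hmB : ∀ {S : Set (HeightOneSpectrum (𝓞 F))}, S.Finite → T ⊆ S → ∀ s : ℂ, 1 < s.re →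
      Multipliable fun v : {v : HeightOneSpectrum (𝓞 F) // v ∉ S} =>
        ((satakePairPolynomial (βi v.1) (uκ v.1)).eval ((v.1.residueCard : ℂ) ^ (-s)))⁻¹)
    (hcB : ∀ {S : Set (HeightOneSpectrum (𝓞 F))}, S.Finite → T ⊆ S → ∀ s : ℂ, 1 < s.re →
      ContinuousAt (partialPairL S βi uκ) s)
    (hmC : ∀ {S : Set (HeightOneSpectrum (𝓞 F))}, S.Finite → T ⊆ S → ∀ s : ℂ, 1 < s.re →
      Multipliable fun v : {v : HeightOneSpectrum (𝓞 F) // v ∉ S} =>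
        ((satakePairPolynomial (β v.1) (u₁ v.1)).eval ((v.1.residueCard : ℂ) ^ (-s)))⁻¹)
    (hcC : ∀ {S : Set (HeightOneSpectrum (𝓞 F))}, S.Finite → T ⊆ S → ∀ s : ℂ, 1 < s.re →
      ContinuousAt (partialPairL S β u₁) s)
    {t : ℝ} (ht : 0 < t)
    (hId : ∀ w ∉ T,
      satakePairPolynomial (W w) ((u₂ w).map (((w.residueCard : ℂ) ^ (((-(2 * t) : ℝ)) : ℂ)) * ·)) *
          satakePairPolynomial ((uν w).map (((w.residueCard : ℂ) ^ (((-(4 * t) : ℝ)) : ℂ)) * ·))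
            (one w) *
          satakePairPolynomial (one w) (one w) =
        satakePairPolynomial (βi w) ((uκ w).map (((w.residueCard : ℂ) ^ (((-(3 * t) : ℝ)) : ℂ)) * ·)) *
          satakePairPolynomial (β w) ((u₁ w).map (((w.residueCard : ℂ) ^ (((-t : ℝ)) : ℂ)) * ·))) :
    False := by
  -- the exceptional sets of the `GL₁` inputs
  obtain ⟨S₂, hS₂, hJ1b⟩ :=
    JacquetShalika1981_multipliable_partialPairL_repData_holds 1 1 F h1 h1 one_pos one_pos τν τ₀
  obtain ⟨S₃, hS₃, hJ1c⟩ :=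
    JacquetShalika1981_multipliable_partialPairL_repData_holds 1 1 F h1 h1 one_pos one_pos τ₀ τ₀
  obtain ⟨S₆, hS₆, hIb⟩ := continuousAt_and_ne_zero_partialPairL_repData τν τ₀
  set S : Set (HeightOneSpectrum (𝓞 F)) := T ∪ S₂ ∪ S₃ ∪ S₆ with hS_def
  have hS : S.Finite := ((hT.union hS₂).union hS₃).union hS₆
  have hTS' : T ⊆ S := fun x hx => by simp [hS_def, hx]
  have hTS : ∀ w ∉ S, w ∉ T := fun w hw hwT => hw (hTS' hwT)
  have sub₂ : S₂ ⊆ S := fun x hx => by simp [hS_def, hx]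
  have sub₃ : S₃ ⊆ S := fun x hx => by simp [hS_def, hx]
  have sub₆ : S₆ ⊆ S := fun x hx => by simp [hS_def, hx]
  have hτ₀S : ∀ w ∉ S, τ₀.1.HasSatakeParamAt w (one w) := fun w hw => hτ₀ w (hTS w hw)
  have hτνS : ∀ w ∉ S, τν.1.HasSatakeParamAt w (uν w) := fun w hw => hτν w (hTS w hw)
  have huone : ∀ w ∉ S, ‖(one w).prod‖ = 1 := fun w _ => by rw [hone]; simp
  have huνS : ∀ w ∉ S, ‖(uν w).prod‖ = 1 := fun w hw => huν w (hTS w hw)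
  -- the shifted families
  set su₂ : SatakeFamily F :=
    fun w => (u₂ w).map (((w.residueCard : ℂ) ^ (((-(2 * t) : ℝ)) : ℂ)) * ·) with hsu₂_def
  set suν : SatakeFamily F :=
    fun w => (uν w).map (((w.residueCard : ℂ) ^ (((-(4 * t) : ℝ)) : ℂ)) * ·) with hsuν_def
  set suκ : SatakeFamily F :=
    fun w => (uκ w).map (((w.residueCard : ℂ) ^ (((-(3 * t) : ℝ)) : ℂ)) * ·) with hsuκ_def
  set su₁ : SatakeFamily F := fun w => (u₁ w).map (((w.residueCard : ℂ) ^ (((-t : ℝ)) : ℂ)) * ·)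
    with hsu₁_def
  have hsu₂ : ∀ w ∉ S, su₂ w = (u₂ w).map (((w.residueCard : ℂ) ^ (((-(2 * t) : ℝ)) : ℂ)) * ·) :=
    fun w _ => rfl
  have hsuν : ∀ w ∉ S, suν w = (uν w).map (((w.residueCard : ℂ) ^ (((-(4 * t) : ℝ)) : ℂ)) * ·) :=
    fun w _ => rfl
  have hsuκ : ∀ w ∉ S, suκ w = (uκ w).map (((w.residueCard : ℂ) ^ (((-(3 * t) : ℝ)) : ℂ)) * ·) :=
    fun w _ => rfl
  have hsu₁ : ∀ w ∉ S, su₁ w = (u₁ w).map (((w.residueCard : ℂ) ^ (((-t : ℝ)) : ℂ)) * ·) :=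
    fun w _ => rfl
  have eA := pairEulerFactor_eq_of_shift (shift_zero_gl4 (S := S) W) hsu₂
  have eN := pairEulerFactor_eq_of_shift hsuν (shift_zero_gl4 (S := S) one)
  have eB := pairEulerFactor_eq_of_shift (shift_zero_gl4 (S := S) βi) hsuκ
  have eC := pairEulerFactor_eq_of_shift (shift_zero_gl4 (S := S) β) hsu₁
  have pA := partialPairL_eq_of_shift (shift_zero_gl4 (S := S) W) hsu₂
  have pN := partialPairL_eq_of_shift hsuν (shift_zero_gl4 (S := S) one)
  have pB := partialPairL_eq_of_shift (shift_zero_gl4 (S := S) βi) hsuκ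
  have pC := partialPairL_eq_of_shift (shift_zero_gl4 (S := S) β) hsu₁
  have reA : ∀ s : ℂ, (s - (0 + (((-(2 * t) : ℝ)) : ℂ))).re = s.re + 2 * t := fun s => by
    simp only [Complex.sub_re, Complex.add_re, Complex.zero_re, Complex.ofReal_re]; ring
  have reN : ∀ s : ℂ, (s - ((((-(4 * t) : ℝ)) : ℂ) + 0)).re = s.re + 4 * t := fun s => by
    simp only [Complex.sub_re, Complex.add_re, Complex.zero_re, Complex.ofReal_re]; ring
  have reB : ∀ s : ℂ, (s - (0 + (((-(3 * t) : ℝ)) : ℂ))).re = s.re + 3 * t := fun s => by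
    simp only [Complex.sub_re, Complex.add_re, Complex.zero_re, Complex.ofReal_re]; ring
  have reC : ∀ s : ℂ, (s - (0 + (((-t : ℝ)) : ℂ))).re = s.re + t := fun s => by
    simp only [Complex.sub_re, Complex.add_re, Complex.zero_re, Complex.ofReal_re]; ring
  -- multipliability of the five Euler products on `Re s > 1`
  have mA : ∀ s : ℂ, 1 < s.re → Multipliable fun v : {v : HeightOneSpectrum (𝓞 F) // v ∉ S} =>
      ((satakePairPolynomial (W v.1) (su₂ v.1)).eval ((v.1.residueCard : ℂ) ^ (-s)))⁻¹ := by
    intro s hs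
    rw [eA s]
    exact hmA hS hTS' (s - (0 + (((-(2 * t) : ℝ)) : ℂ))) (by rw [reA]; linarith)
  have mN : ∀ s : ℂ, 1 < s.re → Multipliable fun v : {v : HeightOneSpectrum (𝓞 F) // v ∉ S} =>
      ((satakePairPolynomial (suν v.1) (one v.1)).eval ((v.1.residueCard : ℂ) ^ (-s)))⁻¹ := by
    intro s hs
    rw [eN s]
    exact hJ1b hS sub₂ hτνS hτ₀S huνS huone (s := s - ((((-(4 * t) : ℝ)) : ℂ) + 0))
      (by rw [reN]; linarith)
  have mZ : ∀ s : ℂ, 1 < s.re → Multipliable fun v : {v : HeightOneSpectrum (𝓞 F) // v ∉ S} =>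
      ((satakePairPolynomial (one v.1) (one v.1)).eval ((v.1.residueCard : ℂ) ^ (-s)))⁻¹ :=
    fun s hs => hJ1c hS sub₃ hτ₀S hτ₀S huone huone hs
  have mB : ∀ s : ℂ, 1 < s.re → Multipliable fun v : {v : HeightOneSpectrum (𝓞 F) // v ∉ S} =>
      ((satakePairPolynomial (βi v.1) (suκ v.1)).eval ((v.1.residueCard : ℂ) ^ (-s)))⁻¹ := by
    intro s hs
    rw [eB s]
    exact hmB hS hTS' (s - (0 + (((-(3 * t) : ℝ)) : ℂ))) (by rw [reB]; linarith)
  have mC : ∀ s : ℂ, 1 < s.re → Multipliable fun v : {v : HeightOneSpectrum (𝓞 F) // v ∉ S} =>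
      ((satakePairPolynomial (β v.1) (su₁ v.1)).eval ((v.1.residueCard : ℂ) ^ (-s)))⁻¹ := by
    intro s hs
    rw [eC s]
    exact hmC hS hTS' (s - (0 + (((-t : ℝ)) : ℂ))) (by rw [reC]; linarith)
  -- the identity of partial `L`-functions on `Re s > 1`
  have hEq : ∀ᶠ s in 𝓝[{s : ℂ | 1 < s.re}] 1,
      partialPairL S W su₂ s * partialPairL S suν one s * partialPairL S one one s =
        partialPairL S βi suκ s * partialPairL S β su₁ s :=
    eventually_nhdsWithin_of_forall fun s hs =>
      partialPairL_mul_mul_eq_mul_of_satakePairPolynomial_eq (fun v hv => hId v (hTS v hv))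
        (mA s hs) (mN s hs) (mZ s hs) (mB s hs) (mC s hs)
  have hl : ∀ z : ℂ, Tendsto (fun s : ℂ => s - z) (𝓝[{s : ℂ | 1 < s.re}] 1) (𝓝 (1 - z)) :=
    fun z => ((continuous_id.sub continuous_const).tendsto 1).mono_left nhdsWithin_le_nhds
  -- `A(s + 2t) → A(1 + 2t) ≠ 0`
  obtain ⟨hcA', hA0⟩ := hcA hS hTS' (1 - (0 + (((-(2 * t) : ℝ)) : ℂ)))
    (by rw [reA, Complex.one_re]; linarith)
  have hA : Tendsto (partialPairL S W su₂) (𝓝[{s : ℂ | 1 < s.re}] 1)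
      (𝓝 (partialPairL S W u₂ (1 - (0 + (((-(2 * t) : ℝ)) : ℂ))))) := by
    rw [pA]
    exact hcA'.tendsto.comp (hl _)
  -- `N(s + 4t) → N(1 + 4t) ≠ 0`
  obtain ⟨hcN, hN0⟩ := hIb hS sub₆ hτνS hτ₀S huνS huone (s := 1 - ((((-(4 * t) : ℝ)) : ℂ) + 0))
    (by rw [reN, Complex.one_re]; linarith)
  have hN : Tendsto (fun s => (s - 1) ^ 0 * partialPairL S suν one s) (𝓝[{s : ℂ | 1 < s.re}] 1)
      (𝓝 (partialPairL S uν one (1 - ((((-(4 * t) : ℝ)) : ℂ) + 0)))) := by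
    simp only [pow_zero, one_mul]
    rw [pN]
    exact hcN.tendsto.comp (hl _)
  -- Hecke: `(s - 1) ζ_F^S(s) → c₀ ≠ 0`
  obtain ⟨c₀, hc₀, hZ⟩ := tendsto_sub_one_mul_partialPairL_one_one hS hone
  -- `B(s + 3t) → B(1 + 3t)`, `C(s + t) → C(1 + t)`
  have hcB' := hcB hS hTS' (1 - (0 + (((-(3 * t) : ℝ)) : ℂ))) (by rw [reB, Complex.one_re]; linarith)
  have hB : Tendsto (partialPairL S βi suκ) (𝓝[{s : ℂ | 1 < s.re}] 1)
      (𝓝 (partialPairL S βi uκ (1 - (0 + (((-(3 * t) : ℝ)) : ℂ))))) := by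
    rw [pB]
    exact hcB'.tendsto.comp (hl _)
  have hcC' := hcC hS hTS' (1 - (0 + (((-t : ℝ)) : ℂ))) (by rw [reC, Complex.one_re]; linarith)
  have hC : Tendsto (partialPairL S β su₁) (𝓝[{s : ℂ | 1 < s.re}] 1)
      (𝓝 (partialPairL S β u₁ (1 - (0 + (((-t : ℝ)) : ℂ))))) := by
    rw [pC]
    exact hcC'.tendsto.comp (hl _)
  exact false_of_pole_pole_nonzero_eq_finite (l := 𝓝[{s : ℂ | 1 < s.re}] 1) 0
    tendsto_sub_one_nhdsWithin_one_lt_re hEq hA hA0 hN hN0 hZ hc₀ hB hC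

end Abstract

/-! ### From Hecke characters to the abstract cores -/

section Construction

variable {F : Type} [Field F] [NumberField F]

/-- **No Hecke character among the Satake eigenvalues of a unitary cuspidal datum on `GL₄` with
cuspidal exterior square, slope `≤ 0`.**  Let `P` be a cuspidal datum on `GL₄(𝔸_F)` with unitary
Satake family `β` a.e., `Pd` one with the inverse family `β⁻¹` a.e. (the contragredient), `Q` a
cuspidal datum on `GL₆(𝔸_F)` with family `∧² β` a.e., `ω` a Hecke character with `ω(ϖ_w) = det β_w`
a.e., and `θ` a Hecke character with `θ(ϖ_w) ∈ β_w` a.e. and `|θ| = ‖·‖^{-t}`, `t ≥ 0` (so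
`|θ(ϖ_w)| = q_w^{t}`).  Granting Jacquet–Shalika (2.2) for Borel–Jacquet data, `False`.  With
`λ = ‖·‖^{-t}` and the unitary characters `u₁ = θ⁻¹ λ`, `u₂ = u₁²`, `uκ = ω u₁³`, `uν = ω u₁⁴`, the
Euler factors at a good place satisfy
`P(∧²β, q^{-2t} u₂) P(q^{-4t} uν, 1) P(1, 1) = P(β⁻¹, q^{-3t} uκ) P(β, q^{-t} u₁)`
(`satakePairPolynomial_threeOne_identity`), i.e. `L(Q × θ⁻²) L(ω θ⁻⁴) ζ_F^S = L(Pd × ω θ⁻³) L(P × θ⁻¹)`;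
the three non-`ζ` slots have analytic packages (`analyticPackage_repData`, ranks `6 ≠ 1`, `4 ≠ 1`),
and `false_of_eulerIdentity_threeOne_of_packages` (`t = 0`) resp.
`false_of_eulerIdentity_threeOne_of_shift_of_packages` (`t > 0`) concludes.
[cite: BockleHui2025, §3.2.1] [cite: ArthurClozelAMS120, Ch. 3 §2 (2.1)–(2.3)] -/
theorem false_of_heckeEigenvalue_mem_satake_gl4
    (hJ2 : JacquetShalika1981_partialPairL_boundary_repData)
    {h4 : isCompact_glFiniteIntegralLevel 4 F} {h6 : isCompact_glFiniteIntegralLevel 6 F}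
    (P Pd : CuspidalAutomorphicRepData 4 F h4) (Q : CuspidalAutomorphicRepData 6 F h6)
    (β : SatakeFamily F)
    (hP : ∀ᶠ w : HeightOneSpectrum (𝓞 F) in cofinite, P.1.HasSatakeParamAt w (β w))
    (hPd : ∀ᶠ w : HeightOneSpectrum (𝓞 F) in cofinite, Pd.1.HasSatakeParamAt w ((β w).map (·⁻¹)))
    (hQ : ∀ᶠ w : HeightOneSpectrum (𝓞 F) in cofinite,
      Q.1.HasSatakeParamAt w (wedgeTwoParams (β w)))
    (huβ : ∀ᶠ w : HeightOneSpectrum (𝓞 F) in cofinite, ‖(β w).prod‖ = 1)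
    (ω : HeckeCharacter F)
    (hω : ∀ᶠ w : HeightOneSpectrum (𝓞 F) in cofinite, ω.valueAtUniformizer w = (β w).prod)
    (θ : HeckeCharacter F)
    (hθ : ∀ᶠ w : HeightOneSpectrum (𝓞 F) in cofinite, θ.valueAtUniformizer w ∈ β w)
    {t : ℝ} (ht : 0 ≤ t)
    (hθt : ∀ x : ideleGroup F, ‖((θ x : ℂˣ) : ℂ)‖ = GaloisRepresentations.ideleNorm x ^ (-t)) :
    False := by
  have h1 : isCompact_glFiniteIntegralLevel 1 F := isCompact_glFiniteIntegralLevel_holds 1 F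
  haveI : NeZero (4 : ℕ) := ⟨by norm_num⟩
  haveI : NeZero (6 : ℕ) := ⟨by norm_num⟩
  obtain ⟨lam, hlam⟩ := exists_heckeCharacter_ideleNorm_cpow F (((-t : ℝ)) : ℂ)
  have hc : ∀ w : HeightOneSpectrum (𝓞 F),
      lam.valueAtUniformizer w = ((w.residueCard : ℂ) ^ (((-t : ℝ)) : ℂ))⁻¹ :=
    HeckeCharacter.valueAtUniformizer_of_cpow hlam
  have hc0 : ∀ w : HeightOneSpectrum (𝓞 F), (w.residueCard : ℂ) ^ (((-t : ℝ)) : ℂ) ≠ 0 :=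
    fun w => qpow_ne_zero_gl4 w _
  have hnθ : ∀ w : HeightOneSpectrum (𝓞 F), ‖θ.valueAtUniformizer w‖ = (w.residueCard : ℝ) ^ t :=
    fun w => by rw [norm_valueAtUniformizer_eq_rpow_neg_of_norm_apply hθt, neg_neg]
  -- the unitary characters `u₁ = θ⁻¹ λ`, `u₂ = u₁²`, `uκ = ω u₁³`, `uν = ω u₁⁴`
  set u₁ : HeckeCharacter F := θ⁻¹ * lam with hu₁def
  set u₂ : HeckeCharacter F := u₁ * u₁ with hu₂def
  set uκ : HeckeCharacter F := ω * u₁ ^ 3 with huκdef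
  set uν : HeckeCharacter F := ω * u₁ ^ 4 with huνdef
  have hu₁w : ∀ w, u₁.valueAtUniformizer w =
      (θ.valueAtUniformizer w)⁻¹ * ((w.residueCard : ℂ) ^ (((-t : ℝ)) : ℂ))⁻¹ := fun w => by
    rw [hu₁def, HeckeCharacter.valueAtUniformizer_mul, HeckeCharacter.valueAtUniformizer_inv, hc]
  have hθinv : ∀ w, (θ.valueAtUniformizer w)⁻¹ =
      (w.residueCard : ℂ) ^ (((-t : ℝ)) : ℂ) * u₁.valueAtUniformizer w := fun w => by
    rw [hu₁w, mul_comm ((θ.valueAtUniformizer w)⁻¹), ← mul_assoc, mul_inv_cancel₀ (hc0 w), one_mul]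
  have hu₂w : ∀ w, u₂.valueAtUniformizer w = u₁.valueAtUniformizer w * u₁.valueAtUniformizer w :=
    fun w => by rw [hu₂def, HeckeCharacter.valueAtUniformizer_mul]
  have huκw : ∀ w, uκ.valueAtUniformizer w =
      ω.valueAtUniformizer w * u₁.valueAtUniformizer w ^ 3 := fun w => by
    rw [huκdef, HeckeCharacter.valueAtUniformizer_mul, HeckeCharacter.valueAtUniformizer_pow]
  have huνw : ∀ w, uν.valueAtUniformizer w =
      ω.valueAtUniformizer w * u₁.valueAtUniformizer w ^ 4 := fun w => by
    rw [huνdef, HeckeCharacter.valueAtUniformizer_mul, HeckeCharacter.valueAtUniformizer_pow]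
  have hnu₁ : ∀ w, ‖u₁.valueAtUniformizer w‖ = 1 := fun w => by
    have hq : (0 : ℝ) < w.residueCard := by exact_mod_cast lt_trans zero_lt_one w.one_lt_residueCard
    rw [hu₁w, norm_mul, norm_inv, norm_inv, hnθ, norm_qpow_gl4, Complex.ofReal_re,
      Real.rpow_neg hq.le, inv_inv, inv_mul_cancel₀ (Real.rpow_pos_of_pos hq t).ne']
  have hnu₂ : ∀ w, ‖u₂.valueAtUniformizer w‖ = 1 := fun w => by rw [hu₂w, norm_mul, hnu₁, one_mul]
  have hnω : ∀ᶠ w : HeightOneSpectrum (𝓞 F) in cofinite, ‖ω.valueAtUniformizer w‖ = 1 := by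
    filter_upwards [hω, huβ] with w h₁ h₂
    rw [h₁, h₂]
  have hnuκ : ∀ᶠ w : HeightOneSpectrum (𝓞 F) in cofinite, ‖uκ.valueAtUniformizer w‖ = 1 :=
    hnω.mono fun w hw => by rw [huκw, norm_mul, norm_pow, hw, hnu₁, one_pow, one_mul]
  have hnuν : ∀ᶠ w : HeightOneSpectrum (𝓞 F) in cofinite, ‖uν.valueAtUniformizer w‖ = 1 :=
    hnω.mono fun w hw => by rw [huνw, norm_mul, norm_pow, hw, hnu₁, one_pow, one_mul]
  -- unitarity of `∧² β` and of `β⁻¹`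
  have huW : ∀ᶠ w : HeightOneSpectrum (𝓞 F) in cofinite, ‖(wedgeTwoParams (β w)).prod‖ = 1 := by
    filter_upwards [hP, huβ] with w h₁ h₂
    rw [prod_wedgeTwoParams_of_card_eq_four h₁.card_eq, norm_pow, h₂, one_pow]
  have huβi : ∀ᶠ w : HeightOneSpectrum (𝓞 F) in cofinite, ‖((β w).map (·⁻¹)).prod‖ = 1 :=
    huβ.mono fun w hw => by rw [Multiset.prod_map_inv, Multiset.map_id', norm_inv, hw, inv_one]
  -- the `GL₁` data and the three packages
  obtain ⟨τ₀, hτ₀⟩ := exists_cuspidal_glOne_hasSatakeParamAt_one h1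
  obtain ⟨τν, hτν⟩ := exists_cuspidal_glOne_hasSatakeParamAt_valueAtUniformizer h1 uν
  obtain ⟨SA, hSA, hAk⟩ := analyticPackage_repData hJ2 (n := 6) (by norm_num) Q
    (fun w => wedgeTwoParams (β w)) hQ huW u₂ (Filter.Eventually.of_forall hnu₂)
  obtain ⟨SB, hSB, hBk⟩ := analyticPackage_repData hJ2 (n := 4) (by norm_num) Pd
    (fun w => (β w).map (·⁻¹)) hPd huβi uκ hnuκ
  obtain ⟨SC, hSC, hCk⟩ := analyticPackage_repData hJ2 (n := 4) (by norm_num) P β hP huβ u₁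
    (Filter.Eventually.of_forall hnu₁)
  -- the good places
  have hgood : ∀ᶠ w : HeightOneSpectrum (𝓞 F) in cofinite,
      P.1.HasSatakeParamAt w (β w) ∧ ω.valueAtUniformizer w = (β w).prod ∧
      θ.valueAtUniformizer w ∈ β w ∧ ‖uν.valueAtUniformizer w‖ = 1 ∧
      τ₀.1.HasSatakeParamAt w {1} ∧ τν.1.HasSatakeParamAt w {uν.valueAtUniformizer w} := by
    filter_upwards [hP, hω, hθ, hnuν, hτ₀, hτν] with w h₁ h₂ h₃ h₄ h₅ h₆
    exact ⟨h₁, h₂, h₃, h₄, h₅, h₆⟩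
  obtain ⟨T₀, hT₀, hgoodT⟩ : ∃ T₀ : Set (HeightOneSpectrum (𝓞 F)), T₀.Finite ∧ ∀ w ∉ T₀,
      P.1.HasSatakeParamAt w (β w) ∧ ω.valueAtUniformizer w = (β w).prod ∧
      θ.valueAtUniformizer w ∈ β w ∧ ‖uν.valueAtUniformizer w‖ = 1 ∧
      τ₀.1.HasSatakeParamAt w {1} ∧ τν.1.HasSatakeParamAt w {uν.valueAtUniformizer w} :=
    ⟨_, Filter.eventually_cofinite.1 hgood, fun w hw => not_not.1 hw⟩
  set T : Set (HeightOneSpectrum (𝓞 F)) := T₀ ∪ SA ∪ SB ∪ SC with hT_def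
  have hT : T.Finite := ((hT₀.union hSA).union hSB).union hSC
  have hT₀T : ∀ w ∉ T, w ∉ T₀ := fun w hw h => hw (by simp [hT_def, h])
  have subA : SA ⊆ T := fun x hx => by simp [hT_def, hx]
  have subB : SB ⊆ T := fun x hx => by simp [hT_def, hx]
  have subC : SC ⊆ T := fun x hx => by simp [hT_def, hx]
  -- powers of the local constant `q_w^{-t}`
  have hck : ∀ (k : ℕ) (w : HeightOneSpectrum (𝓞 F)),
      (w.residueCard : ℂ) ^ (((-(k * t) : ℝ)) : ℂ) = ((w.residueCard : ℂ) ^ (((-t : ℝ)) : ℂ)) ^ k :=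
    fun k w => by
    rw [← Complex.cpow_nat_mul]; congr 1; push_cast; ring
  -- the Euler-factor identity at a good place
  have hId : ∀ w ∉ T,
      satakePairPolynomial (wedgeTwoParams (β w))
            (({u₂.valueAtUniformizer w} : Multiset ℂ).map
              (((w.residueCard : ℂ) ^ (((-(2 * t) : ℝ)) : ℂ)) * ·)) *
          satakePairPolynomial
            (({uν.valueAtUniformizer w} : Multiset ℂ).map
              (((w.residueCard : ℂ) ^ (((-(4 * t) : ℝ)) : ℂ)) * ·)) {1} *
          satakePairPolynomial {1} {1} =
        satakePairPolynomial ((β w).map (·⁻¹))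
            (({uκ.valueAtUniformizer w} : Multiset ℂ).map
              (((w.residueCard : ℂ) ^ (((-(3 * t) : ℝ)) : ℂ)) * ·)) *
          satakePairPolynomial (β w)
            (({u₁.valueAtUniformizer w} : Multiset ℂ).map
              (((w.residueCard : ℂ) ^ (((-t : ℝ)) : ℂ)) * ·)) := by
    intro w hw
    have hg := hgoodT w (hT₀T w hw)
    obtain ⟨γ, hγ⟩ := Multiset.exists_cons_of_mem hg.2.2.1
    have hcardγ : Multiset.card γ = 3 := by
      have h4c := hg.1.card_eq
      rw [hγ, Multiset.card_cons] at h4c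
      omega
    obtain ⟨a, b, c, rfl⟩ := Multiset.card_eq_three.1 hcardγ
    have hθ0 : θ.valueAtUniformizer w ≠ 0 := heckeCharacter_valueAtUniformizer_ne_zero θ w
    have hC0 : (w.residueCard : ℂ) ^ (((-t : ℝ)) : ℂ) ≠ 0 := hc0 w
    have h0 : (0 : ℂ) ∉ β w := fun h0 => hasSatakeParamAt_ne_zero_holds hg.1 0 h0 rfl
    have ha : a ≠ 0 := fun h => h0 (by rw [hγ, h]; simp)
    have hb : b ≠ 0 := fun h => h0 (by rw [hγ, h]; simp)
    have hcc : c ≠ 0 := fun h => h0 (by rw [hγ, h]; simp)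
    have hprod : (β w).prod = θ.valueAtUniformizer w * (a * (b * c)) := by
      rw [hγ, Multiset.prod_cons, Multiset.insert_eq_cons, Multiset.insert_eq_cons,
        Multiset.prod_cons, Multiset.prod_cons, Multiset.prod_singleton]
    have e₂ : ({u₂.valueAtUniformizer w} : Multiset ℂ).map
        (((w.residueCard : ℂ) ^ (((-(2 * t) : ℝ)) : ℂ)) * ·) = {(θ.valueAtUniformizer w ^ 2)⁻¹} := by
      rw [Multiset.map_singleton, show (2 : ℝ) * t = ((2 : ℕ) : ℝ) * t by push_cast; ring, hck,
        hu₂w, hu₁w]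
      congr 1
      field_simp
    have eν : ({uν.valueAtUniformizer w} : Multiset ℂ).map
        (((w.residueCard : ℂ) ^ (((-(4 * t) : ℝ)) : ℂ)) * ·) =
          {θ.valueAtUniformizer w * (a * (b * c)) * (θ.valueAtUniformizer w ^ 4)⁻¹} := by
      rw [Multiset.map_singleton, show (4 : ℝ) * t = ((4 : ℕ) : ℝ) * t by push_cast; ring, hck,
        huνw, hg.2.1, hprod, hu₁w]
      congr 1
      field_simp
    have eκ : ({uκ.valueAtUniformizer w} : Multiset ℂ).map
        (((w.residueCard : ℂ) ^ (((-(3 * t) : ℝ)) : ℂ)) * ·) =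
          {θ.valueAtUniformizer w * (a * (b * c)) * (θ.valueAtUniformizer w ^ 3)⁻¹} := by
      rw [Multiset.map_singleton, show (3 : ℝ) * t = ((3 : ℕ) : ℝ) * t by push_cast; ring, hck,
        huκw, hg.2.1, hprod, hu₁w]
      congr 1
      field_simp
    have e₁ : ({u₁.valueAtUniformizer w} : Multiset ℂ).map
        (((w.residueCard : ℂ) ^ (((-t : ℝ)) : ℂ)) * ·) = {(θ.valueAtUniformizer w)⁻¹} := by
      rw [Multiset.map_singleton, ← hθinv]
    rw [e₂, eν, eκ, e₁, hγ]
    exact satakePairPolynomial_threeOne_identity ha hb hcc hθ0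
  -- dispatch on the slope
  rcases ht.eq_or_lt with h0t | htpos
  · subst h0t
    refine false_of_eulerIdentity_threeOne_of_packages τ₀ τν (fun _ => {1})
      (fun w => {u₂.valueAtUniformizer w}) (fun w => {uν.valueAtUniformizer w})
      (fun w => {uκ.valueAtUniformizer w}) (fun w => {u₁.valueAtUniformizer w})
      (fun w => wedgeTwoParams (β w)) (fun w => (β w).map (·⁻¹)) β hT (fun _ => rfl)
      (fun w hw => (hgoodT w (hT₀T w hw)).2.2.2.2.1) (fun w hw => (hgoodT w (hT₀T w hw)).2.2.2.2.2)
      (fun w hw => by rw [Multiset.prod_singleton]; exact (hgoodT w (hT₀T w hw)).2.2.2.1)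
      (fun hS hTS s hs => (hAk hS (subA.trans hTS)).1 s hs)
      (fun hS hTS => (hAk hS (subA.trans hTS)).2.2)
      (fun hS hTS s hs => (hBk hS (subB.trans hTS)).1 s hs)
      (fun hS hTS => ?_) (fun hS hTS s hs => (hCk hS (subC.trans hTS)).1 s hs) (fun hS hTS => ?_)
      (fun w hw => ?_)
    · obtain ⟨c, -, h⟩ := (hBk hS (subB.trans hTS)).2.2
      exact ⟨c, h⟩
    · obtain ⟨c, -, h⟩ := (hCk hS (subC.trans hTS)).2.2
      exact ⟨c, h⟩
    · have h := hId w hw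
      simpa only [mul_zero, neg_zero, Complex.ofReal_zero, Complex.cpow_zero, one_mul,
        Multiset.map_id'] using h
  · exact false_of_eulerIdentity_threeOne_of_shift_of_packages τ₀ τν (fun _ => {1})
      (fun w => {u₂.valueAtUniformizer w}) (fun w => {uν.valueAtUniformizer w})
      (fun w => {uκ.valueAtUniformizer w}) (fun w => {u₁.valueAtUniformizer w})
      (fun w => wedgeTwoParams (β w)) (fun w => (β w).map (·⁻¹)) β hT (fun _ => rfl)
      (fun w hw => (hgoodT w (hT₀T w hw)).2.2.2.2.1) (fun w hw => (hgoodT w (hT₀T w hw)).2.2.2.2.2)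
      (fun w hw => by rw [Multiset.prod_singleton]; exact (hgoodT w (hT₀T w hw)).2.2.2.1)
      (fun hS hTS s hs => (hAk hS (subA.trans hTS)).1 s hs)
      (fun hS hTS s hs => (hAk hS (subA.trans hTS)).2.1 s hs)
      (fun hS hTS s hs => (hBk hS (subB.trans hTS)).1 s hs)
      (fun hS hTS s hs => ((hBk hS (subB.trans hTS)).2.1 s hs).1)
      (fun hS hTS s hs => (hCk hS (subC.trans hTS)).1 s hs)
      (fun hS hTS s hs => ((hCk hS (subC.trans hTS)).2.1 s hs).1) htpos hId

end Construction

end Literature.NumberTheory.Automorphic
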